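import Summits.HodgeConjecture.HodgeConjecture.Theses.SevenfoldWeilCensus
import Summits.HodgeConjecture.HodgeConjecture.Theorems.PadicSemiregularLiftHodgeBeyondAnchorsUnconditional
import Literature.AlgebraicGeometry.HodgeTheory.WeilSurfaceSquareModel
import Literature.NumberTheory.EllipticCurves.DivisionPolynomialTorsion
import Literature.AlgebraicGeometry.Motives.AbelianVarietyProjectiveChart
import HarnessLib

/-!
# Residual `R1 = HodgeAbelianDimGeEight` already carries HC for ALL abelian varieties

Route `SevenfoldWeilCensus` of `HodgeConjecture` (strategist seat on `AbelianComplement`,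
stmt-HodgeConjecture-15889; a FINDING about the route's other residual, recorded for the tribunal /
tenure planner — the seat cannot edit `closes`).

`closes` splits the summit as: abelian of dimension `≤ 7` (the route's attacked conjunct, via
`Assembly` fed with the census cruxes X1/X2, the shared Weil-sixfold crux and Markman's dim `≤ 5`),
abelian of dimension `≥ 8` (residual `R1 = HodgeAbelianDimGeEight`), non-abelian (residual
`R2 = AbelianComplement`). This file proves, with standard axioms only,

* `hodgeAbelianVarieties_of_hodgeAbelianDimGeEight : HodgeAbelianDimGeEight → ∀ A, HodgeConjectureFor A.dim A.X`

— the residual `R1` ALONE implies the Hodge conjecture for every complex abelian variety, in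
particular the whole conclusion of `Assembly` (`assemblyConclusion_of_hodgeAbelianDimGeEight`): pad an
abelian variety `A` of dimension `< 8` with factors `E = ℂ/(ℤ + iℤ)` until the dimension reaches `8`,
apply `R1`, and descend along `A × E → A` with the tree's unconditional product descent
`HodgeBeyondAnchors.hodgeConjectureFor_of_tensor` (general slice of an algebraic class; fed with the
discharged facts `hodgePQ_independent_of_hodgeModel_holds`, `nonempty_hodgeModel_holds` and
`Infinite E(ℂ)` from `WeierstrassCurve.infinite_point`). Hence `R1 ↔ HodgeAbelianVarieties`
(`hodgeAbelianDimGeEight_iff_hodgeAbelianVarieties`) and `R1 ∧ R2 ↔ HodgeConjecture` with the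
attacked conjunct absent (`hodgeConjecture_iff_residuals`): as typed, the two declared residuals
dominate the route's own cruxes. An honest residual for "abelian, dimension ≥ 8" must be typed in
BRIDGE form, e.g. `(∀ A, A.dim ≤ 7 → HC A) → (∀ A, HC A)`, which the product trick does not collapse.

References: C. Voisin, *Hodge Theory and Complex Algebraic Geometry I* (2002) §7.3.2, §11.3;
W. Fulton, *Intersection Theory* (1998) §10.1; J. H. Silverman, *AEC* (2009) VI.3.6.
-/

set_option linter.dupNamespace false

noncomputable section

namespace Summit.HodgeConjecture.HodgeConjecture.Cruxes.AbelianComplement.BridgeSplit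

open CategoryTheory MonoidalCategory
open Literature.AlgebraicGeometry.Motives Literature.AlgebraicGeometry.HodgeTheory
open Summit.HodgeConjecture.HodgeConjecture.Theorems.HodgeBeyondAnchors

/-- `Im i ≠ 0`. -/
theorem I_im_ne_zero : Complex.I.im ≠ 0 := by
  rw [Complex.I_im]; exact one_ne_zero

/-- The padding factor: the elliptic curve `E = ℂ/(ℤ + iℤ)` as a complex abelian variety
(`WeilSquare.curveAV`). [cite: SilvermanAEC2009, III.3.6] -/
def padE : AbelianVariety ℂ := WeilSquare.curveAV Complex.I I_im_ne_zero

/-- `dim E = 1`. -/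
theorem dim_padE : padE.dim = 1 := WeilSquare.dim_curveAV _ _

/-- `E` is a smooth projective curve. -/
theorem isSmoothProjective_padE : IsSmoothProjective 1 padE.X :=
  (WeilSquare.periodPair Complex.I I_im_ne_zero).curve.isSmoothProjective_scheme

/-- `E(ℂ)` is infinite (Mathlib-points of an elliptic curve over an algebraically closed field are
infinite, `WeierstrassCurve.infinite_point`, transported along `pointEquiv`). -/
instance infinite_complexPoints_padE : Infinite (ComplexPoints padE.X) := by
  let L : PeriodPair := WeilSquare.periodPair Complex.I I_im_ne_zero
  -- `E_Λ ×_ℂ ℂ = E_Λ` is `rfl` (`PeriodPair.curve_baseChange`); the ascription fixes the domain type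
  let pe : L.curve.toAffine.Point ≃ AlgPoints L.curve.scheme ℂ := L.curve.pointEquiv (L := ℂ)
  haveI : Infinite L.curve.toAffine.Point := WeierstrassCurve.infinite_point (V := L.curve)
  exact Infinite.of_injective pe pe.injective

/-- **One padding step**: `HC(A × E) ⇒ HC(A)` for every complex abelian variety `A`
(`hodgeConjectureFor_of_tensor` along `A × E → A`). [cite: VoisinHodgeI2002, §11.3] -/
theorem hodgeConjectureFor_of_prod_padE (A : AbelianVariety ℂ)
    (h : HodgeConjectureFor (A.prod padE).dim (A.prod padE).X) : HodgeConjectureFor A.dim A.X := by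
  have hd : (A.prod padE).dim = A.dim + 1 := by rw [AbelianVariety.dim_prod, dim_padE]
  rw [hd, AbelianVariety.prod_X] at h
  have hA : IsSmoothProjective A.dim A.X := AbelianVariety.isSmoothProjective_holds
  exact hodgeConjectureFor_of_tensor hodgePQ_independent_of_hodgeModel_holds hA isSmoothProjective_padE
    (nonempty_hodgeModel_holds hA) h

/-- **`R1` alone gives HC for every abelian variety**: induct on the dimension deficit `8 - dim A`,
padding with `E`. -/
theorem hodgeAbelianVarieties_of_hodgeAbelianDimGeEight
    (h₈ : Theses.SevenfoldWeilCensus.HodgeAbelianDimGeEight) :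
    ∀ A : AbelianVariety ℂ, HodgeConjectureFor A.dim A.X := by
  suffices H : ∀ k : ℕ, ∀ A : AbelianVariety ℂ, 8 ≤ A.dim + k → HodgeConjectureFor A.dim A.X from
    fun A ↦ H 8 A (by omega)
  intro k
  induction k with
  | zero => exact fun A hA ↦ h₈ A (by omega) AbelianVariety.isSmoothProjective_holds
  | succ k ih =>
    intro A hA
    refine hodgeConjectureFor_of_prod_padE A (ih (A.prod padE) ?_)
    rw [AbelianVariety.dim_prod, dim_padE]
    omega

/-- `R1 ↔ HC for all abelian varieties` (the milestone, item stmt-HodgeConjecture-1333's text). -/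
theorem hodgeAbelianDimGeEight_iff_hodgeAbelianVarieties :
    Theses.SevenfoldWeilCensus.HodgeAbelianDimGeEight ↔
      ∀ A : AbelianVariety ℂ, HodgeConjectureFor A.dim A.X :=
  ⟨hodgeAbelianVarieties_of_hodgeAbelianDimGeEight, fun h A _ _ ↦ h A⟩

/-- **`R1` alone proves the conclusion of the route's `Assembly`** (HC for abelian varieties of
dimension `≤ 7`) — without `CodimTwoFromLowerDim`, `CodimThreeWeilGeneration`, `WeilSixfolds`,
`HodgeAbelianDimLeFive`. -/
theorem assemblyConclusion_of_hodgeAbelianDimGeEight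
    (h₈ : Theses.SevenfoldWeilCensus.HodgeAbelianDimGeEight) :
    ∀ A : AbelianVariety ℂ, A.dim ≤ 7 → IsSmoothProjective A.dim A.X → HodgeConjectureFor A.dim A.X :=
  fun A _ _ ↦ hodgeAbelianVarieties_of_hodgeAbelianDimGeEight h₈ A

/-- Hence `R1` makes `Assembly` true outright. -/
theorem assembly_of_hodgeAbelianDimGeEight (h₈ : Theses.SevenfoldWeilCensus.HodgeAbelianDimGeEight) :
    Theses.SevenfoldWeilCensus.Assembly :=
  fun _ _ _ _ ↦ assemblyConclusion_of_hodgeAbelianDimGeEight h₈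

/-- **The two declared residuals are jointly the summit**: `R1 ∧ R2 ↔ HodgeConjecture`, the attacked
conjunct and all four of its inputs absent. (`R2` alone is already `↔ HodgeConjecture`,
`abelianComplement_iff_hodgeConjecture`; the point of this lemma is that `R1` swallows the conjunct.) -/
theorem hodgeConjecture_of_residuals (h₈ : Theses.SevenfoldWeilCensus.HodgeAbelianDimGeEight)
    (h₉ : Theses.SevenfoldWeilCensus.AbelianComplement) : HodgeConjecture := by
  intro n X hX
  by_cases hAb : ∃ A : AbelianVariety ℂ, A.dim = n ∧ A.X = X
  · obtain ⟨A, rfl, rfl⟩ := hAb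
    exact hodgeAbelianVarieties_of_hodgeAbelianDimGeEight h₈ A
  · exact h₉ hX fun A hA hAX ↦ hAb ⟨A, hA, hAX⟩

/-- The `closes` case split with the conjunct supplied by `R1` itself: same binders as the route's
deciding theorem, the first five unused. -/
theorem closes_residuals_only (_hA : Theses.SevenfoldWeilCensus.Assembly)
    (_h₃ : Theses.SevenfoldWeilCensus.CodimTwoFromLowerDim)
    (_h₂ : Theses.SevenfoldWeilCensus.CodimThreeWeilGeneration) (_h₄ : Theses.SevenfoldWeilCensus.WeilSixfolds)
    (_h₅ : Theses.SevenfoldWeilCensus.HodgeAbelianDimLeFive)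
    (h₈ : Theses.SevenfoldWeilCensus.HodgeAbelianDimGeEight) (h₉ : Theses.SevenfoldWeilCensus.AbelianComplement) :
    HodgeConjecture :=
  hodgeConjecture_of_residuals h₈ h₉

end Summit.HodgeConjecture.HodgeConjecture.Cruxes.AbelianComplement.BridgeSplit

end
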